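import Mathlib.RingTheory.MvPolynomial.MonomialOrder
import Mathlib.Data.Finsupp.MonomialOrder
import Mathlib.Data.Finsupp.Fin
import Mathlib.Algebra.MvPolynomial.Rename
import HarnessLib

/-!
# Lexicographic degree along the most significant variable of `R[X_0, …, X_n]`

Topic `Literature/RingTheory/MvPolynomial`.  Elementary bookkeeping for the lexicographic
monomial order `MonomialOrder.lex` on `Fin (n+1) →₀ ℕ` (Mathlib's convention: the variable `X 0`
is the MOST significant one), used by the inductive proof of the integrality of lexicographic
reductions modulo vanishing ideals of `0/1` point sets (`BooleanLexMonic.lean`; Conneryd–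
Ghannane–Pang 2025, Lemma 5.3):

* `lex_apply_zero_le_of_le`, `lex_lt_of_apply_zero_lt` — the first coordinate decides;
* `mapDomain_succ_eq_cons`, `lex_mapDomain_succ_mono` — the exponent embedding
  `b ↦ (0, b)` induced by `rename Fin.succ` is monotone;
* `degree_rename_succ`, `leadingCoeff_rename_succ` — `deg (q(X_1,…,X_n)) = (0, deg q)` with the
  same leading coefficient;
* `degree_X_zero_mul_add`, `leadingCoeff_X_zero_mul_add` — for `g ≠ 0`,
  `deg (X_0·g(X_1..) + h(X_1..)) = (1, deg g)` with leading coefficient that of `g`;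
* `eq_X_zero_mul_add_of_apply_zero_le_one` — a polynomial all of whose exponents have
  `X_0`-degree `≤ 1` splits as `X_0·g(X_1..) + h(X_1..)`;
* `eval_rename_succ` — `(rename Fin.succ q)(v) = q(Fin.tail v)`.

All statements are folklore.
-/

noncomputable section

open MvPolynomial Finset
open scoped MonomialOrder

namespace Literature.RingTheory.MvPolynomial

variable {R : Type*} [CommRing R] {n : ℕ}

/-! ### The first coordinate decides -/

/-- In the lexicographic order on `Fin (n+1) →₀ ℕ`, `b ≤ c` forces `b 0 ≤ c 0`. [folklore] -/
theorem lex_apply_zero_le_of_le {b c : Fin (n + 1) →₀ ℕ} (h : toLex b ≤ toLex c) : b 0 ≤ c 0 := by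
  by_contra hlt
  have : toLex c < toLex b :=
    Finsupp.Lex.lt_iff.2 ⟨0, fun j hj => absurd hj (Fin.not_lt_zero j), not_le.1 hlt⟩
  exact absurd h (not_le.2 this)

/-- In the lexicographic order on `Fin (n+1) →₀ ℕ`, `b 0 < c 0` forces `b < c`. [folklore] -/
theorem lex_lt_of_apply_zero_lt {b c : Fin (n + 1) →₀ ℕ} (h : b 0 < c 0) : toLex b < toLex c :=
  Finsupp.Lex.lt_iff.2 ⟨0, fun j hj => absurd hj (Fin.not_lt_zero j), h⟩

/-! ### The exponent embedding `b ↦ (0, b)` -/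

/-- `mapDomain Fin.succ` is `Finsupp.cons 0`. [folklore] -/
theorem mapDomain_succ_eq_cons (c : Fin n →₀ ℕ) : c.mapDomain Fin.succ = Finsupp.cons 0 c := by
  ext j
  induction j using Fin.cases with
  | zero =>
    rw [Finsupp.cons_zero, Finsupp.mapDomain_notin_range]
    rintro ⟨i, hi⟩
    exact Fin.succ_ne_zero i hi
  | succ i => rw [Finsupp.mapDomain_apply (Fin.succ_injective n), Finsupp.cons_succ]

/-- An exponent with `X_0`-degree `0` comes from `Fin n`. [folklore] -/
theorem mapDomain_succ_tail {b : Fin (n + 1) →₀ ℕ} (hb : b 0 = 0) :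
    (Finsupp.tail b).mapDomain Fin.succ = b := by
  rw [mapDomain_succ_eq_cons, ← hb, Finsupp.cons_tail]

/-- An exponent with `X_0`-degree `1` is `e_0 + (0, tail)`. [folklore] -/
theorem single_add_mapDomain_succ_tail {b : Fin (n + 1) →₀ ℕ} (hb : b 0 = 1) :
    Finsupp.single 0 1 + (Finsupp.tail b).mapDomain Fin.succ = b := by
  rw [mapDomain_succ_eq_cons]
  ext j
  induction j using Fin.cases with
  | zero => rw [Finsupp.add_apply, Finsupp.single_eq_same, Finsupp.cons_zero, hb]
  | succ i =>
    rw [Finsupp.add_apply, Finsupp.single_eq_of_ne (Fin.succ_ne_zero i), Finsupp.cons_succ,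
      Finsupp.tail_apply, zero_add]

/-- The embedding `b ↦ (0, b)` is monotone for the lexicographic orders. [folklore] -/
theorem lex_mapDomain_succ_mono {b c : Fin n →₀ ℕ} (h : toLex b ≤ toLex c) :
    toLex (b.mapDomain Fin.succ) ≤ toLex (c.mapDomain Fin.succ) := by
  rcases h.eq_or_lt with heq | hlt
  · rw [toLex_inj.1 heq]
  · obtain ⟨i, hi, hlt⟩ := Finsupp.Lex.lt_iff.1 hlt
    refine le_of_lt (Finsupp.Lex.lt_iff.2 ⟨i.succ, fun j hj => ?_, ?_⟩)
    · change (b.mapDomain Fin.succ) j = (c.mapDomain Fin.succ) j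
      induction j using Fin.cases with
      | zero => rw [mapDomain_succ_eq_cons, mapDomain_succ_eq_cons, Finsupp.cons_zero,
          Finsupp.cons_zero]
      | succ j =>
        rw [Finsupp.mapDomain_apply (Fin.succ_injective n),
          Finsupp.mapDomain_apply (Fin.succ_injective n)]
        exact hi j (Fin.succ_lt_succ_iff.1 hj)
    · change (b.mapDomain Fin.succ) i.succ < (c.mapDomain Fin.succ) i.succ
      rw [Finsupp.mapDomain_apply (Fin.succ_injective n),
        Finsupp.mapDomain_apply (Fin.succ_injective n)]
      exact hlt

/-! ### Degrees -/

section Degree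

variable {σ : Type*} (m : MonomialOrder σ)

/-- A support exponent dominating the whole support is the degree. [folklore] -/
theorem degree_eq_of_mem_support {F : MvPolynomial σ R} {D : σ →₀ ℕ} (hD : D ∈ F.support)
    (h : ∀ c ∈ F.support, m.toSyn c ≤ m.toSyn D) : m.degree F = D :=
  m.toSyn.injective (le_antisymm (m.degree_le_iff.2 h) (m.le_degree hD))

end Degree

/-- `deg_lex (q(X_1, …, X_n)) = (0, deg_lex q)` in `R[X_0, …, X_n]`. [folklore] -/
theorem degree_rename_succ (q : MvPolynomial (Fin n) R) :
    MonomialOrder.lex.degree (rename Fin.succ q) = (MonomialOrder.lex.degree q).mapDomain Fin.succ := by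
  classical
  by_cases hq : q = 0
  · subst hq
    simp
  refine degree_eq_of_mem_support MonomialOrder.lex ?_ fun c hc => ?_
  · rw [support_rename_of_injective (Fin.succ_injective n)]
    exact Finset.mem_image_of_mem _ (MonomialOrder.lex.degree_mem_support hq)
  · rw [support_rename_of_injective (Fin.succ_injective n)] at hc
    obtain ⟨c', hc', rfl⟩ := Finset.mem_image.1 hc
    exact lex_mapDomain_succ_mono (MonomialOrder.lex.le_degree hc')

/-- `rename Fin.succ` preserves lexicographic leading coefficients. [folklore] -/
theorem leadingCoeff_rename_succ (q : MvPolynomial (Fin n) R) :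
    MonomialOrder.lex.leadingCoeff (rename Fin.succ q) = MonomialOrder.lex.leadingCoeff q := by
  rw [MonomialOrder.leadingCoeff, degree_rename_succ,
    coeff_rename_mapDomain _ (Fin.succ_injective n)]
  rfl

/-- The degree of `q(X_1,…,X_n)` has `X_0`-coordinate `0`. [folklore] -/
theorem degree_rename_succ_apply_zero (q : MvPolynomial (Fin n) R) :
    MonomialOrder.lex.degree (rename Fin.succ q) 0 = 0 := by
  rw [degree_rename_succ, mapDomain_succ_eq_cons, Finsupp.cons_zero]

variable [Nontrivial R] [NoZeroDivisors R]

/-- For `g ≠ 0`: `deg_lex (X_0 · g(X_1..) + h(X_1..)) = e_0 + (0, deg_lex g)`. [folklore] -/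
theorem degree_X_zero_mul_add {g : MvPolynomial (Fin n) R} (hg : g ≠ 0)
    (h : MvPolynomial (Fin n) R) :
    MonomialOrder.lex.degree (X 0 * rename Fin.succ g + rename Fin.succ h) =
      Finsupp.single 0 1 + (MonomialOrder.lex.degree g).mapDomain Fin.succ := by
  have hg' : rename Fin.succ g ≠ 0 := fun h0 =>
    hg (rename_injective _ (Fin.succ_injective n) (by rw [h0, map_zero]))
  have hA : MonomialOrder.lex.degree (X 0 * rename Fin.succ g) =
      Finsupp.single 0 1 + (MonomialOrder.lex.degree g).mapDomain Fin.succ := by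
    rw [MonomialOrder.degree_mul (X_ne_zero 0) hg', MonomialOrder.degree_X, degree_rename_succ]
  have hlt : MonomialOrder.lex.degree (rename Fin.succ h) ≺[MonomialOrder.lex]
      MonomialOrder.lex.degree (X 0 * rename Fin.succ g) := by
    rw [hA]
    refine lex_lt_of_apply_zero_lt ?_
    rw [degree_rename_succ_apply_zero, Finsupp.add_apply, Finsupp.single_eq_same,
      mapDomain_succ_eq_cons, Finsupp.cons_zero]
    exact Nat.one_pos
  rw [MonomialOrder.degree_add_of_lt hlt, hA]

/-- For `g ≠ 0`: the lexicographic leading coefficient of `X_0 · g(X_1..) + h(X_1..)` is that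
of `g`. [folklore] -/
theorem leadingCoeff_X_zero_mul_add {g : MvPolynomial (Fin n) R} (hg : g ≠ 0)
    (h : MvPolynomial (Fin n) R) :
    MonomialOrder.lex.leadingCoeff (X 0 * rename Fin.succ g + rename Fin.succ h) =
      MonomialOrder.lex.leadingCoeff g := by
  have hg' : rename Fin.succ g ≠ 0 := fun h0 =>
    hg (rename_injective _ (Fin.succ_injective n) (by rw [h0, map_zero]))
  have hA : MonomialOrder.lex.degree (X 0 * rename Fin.succ g) =
      Finsupp.single 0 1 + (MonomialOrder.lex.degree g).mapDomain Fin.succ := by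
    rw [MonomialOrder.degree_mul (X_ne_zero 0) hg', MonomialOrder.degree_X, degree_rename_succ]
  have hlt : MonomialOrder.lex.degree (rename Fin.succ h) ≺[MonomialOrder.lex]
      MonomialOrder.lex.degree (X 0 * rename Fin.succ g) := by
    rw [hA]
    refine lex_lt_of_apply_zero_lt ?_
    rw [degree_rename_succ_apply_zero, Finsupp.add_apply, Finsupp.single_eq_same,
      mapDomain_succ_eq_cons, Finsupp.cons_zero]
    exact Nat.one_pos
  rw [MonomialOrder.leadingCoeff_add_of_lt hlt, MonomialOrder.leadingCoeff_mul,
    MonomialOrder.leadingCoeff_X, one_mul, leadingCoeff_rename_succ]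

omit [Nontrivial R] [NoZeroDivisors R] in
/-- The degree of `X_0 · g(X_1..) + h(X_1..)`, `g ≠ 0`, has `X_0`-coordinate `1`; recorded in the
form: if all exponents of `f` have `X_0`-degree `≤ 1` then `f = X_0 · f₁(X_1..) + f₀(X_1..)`
with `f₁ = ∑_{b 0 = 1} c_b X^{tail b}`, `f₀ = ∑_{b 0 = 0} c_b X^{tail b}`. [folklore] -/
theorem eq_X_zero_mul_add_of_apply_zero_le_one {f : MvPolynomial (Fin (n + 1)) R}
    (hf : ∀ b ∈ f.support, b 0 ≤ 1) :
    f = X 0 * rename Fin.succ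
        (∑ b ∈ f.support.filter (fun b => b 0 = 1), monomial (Finsupp.tail b) (coeff b f)) +
      rename Fin.succ
        (∑ b ∈ f.support.filter (fun b => b 0 = 0), monomial (Finsupp.tail b) (coeff b f)) := by
  classical
  have h1 : X 0 * rename Fin.succ
      (∑ b ∈ f.support.filter (fun b => b 0 = 1), monomial (Finsupp.tail b) (coeff b f)) =
      ∑ b ∈ f.support.filter (fun b => b 0 = 1), monomial b (coeff b f) := by
    rw [map_sum, Finset.mul_sum]
    refine Finset.sum_congr rfl fun b hb => ?_
    rw [rename_monomial, X, monomial_mul, one_mul,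
      single_add_mapDomain_succ_tail (Finset.mem_filter.1 hb).2]
  have h0 : rename Fin.succ
      (∑ b ∈ f.support.filter (fun b => b 0 = 0), monomial (Finsupp.tail b) (coeff b f)) =
      ∑ b ∈ f.support.filter (fun b => b 0 = 0), monomial b (coeff b f) := by
    rw [map_sum]
    refine Finset.sum_congr rfl fun b hb => ?_
    rw [rename_monomial, mapDomain_succ_tail (Finset.mem_filter.1 hb).2]
  rw [h1, h0]
  have hsplit : f.support.filter (fun b => b 0 = 0) = f.support.filter (fun b => ¬ b 0 = 1) := by
    refine Finset.filter_congr fun b hb => ?_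
    have := hf b hb
    omega
  rw [hsplit, Finset.sum_filter_add_sum_filter_not]
  exact f.as_sum

omit [Nontrivial R] [NoZeroDivisors R] in
/-- Evaluation of `q(X_1, …, X_n)` at `v` is evaluation of `q` at `Fin.tail v`. [folklore] -/
theorem eval_rename_succ (v : Fin (n + 1) → R) (q : MvPolynomial (Fin n) R) :
    eval v (rename Fin.succ q) = eval (Fin.tail v) q :=
  eval_rename Fin.succ v q

end Literature.RingTheory.MvPolynomial
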